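import Mathlib.Algebra.CharP.Defs
import Mathlib.Analysis.Complex.Basic
import Literature.Computability.AlgebraicComplexity.DeterminantalComplexity
import Literature.Computability.AlgebraicComplexity.StandardFamilies
import HarnessLib

/-!
# The determinantal complexity of the `3 × 3` and `4 × 4` permanents (Alper–Bogart–Velasco), named fact

J. Alper, T. Bogart, M. Velasco, *A lower bound for the determinantal complexity of a
hypersurface*, Found. Comput. Math. 17 (2017) 829–836 (arXiv:1505.02205), prove (Theorem 1.2) that
a homogeneous `f` of degree `d > 2` with `codim Sing(f) > 4` has `dc(f) ≥ codim Sing(f) + 1`, where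
`dc` is the AFFINE determinantal complexity (their Def. 1.1: "an affine linear map
`L : kⁿ → k^{m×m}` such that `f(x) = det_m(L(x))`" — exactly the tree's
`Literature.Computability.AlgebraicComplexity.determinantalComplexity`, an `sInf` over affine
determinantal representations `IsAffineDetRepr`). Since `codim Sing(perm_3) = 6` and
`codim Sing(perm_4) = 8` in characteristic `≠ 2` (von zur Gathen), and `dc(perm_3) ≤ 7` (Grenet),
they obtain:

> **Corollary 1.4.** Let `k` be a field with `char(k) ≠ 2`. Then `dc(perm_3) = 7` and
> `dc(perm_4) ≥ 9`.

(READ on the materialised text, arXiv:1505.02205 p.3.) This file vendors Corollary 1.4 AS PRINTED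
as ONE named fact (`def … : Prop`, CONVENTIONS §4); the general Theorem 1.2 is not vendored here (it
needs the codimension of the singular locus of an affine hypersurface, not yet in the tree).
In the tree already: the Mignon–Ressayre bound `n² ≤ 2·dc(per_n)` (which gives only `5 ≤ dc(per_3)`,
`8 ≤ dc(per_4)`; `sq_le_two_mul_determinantalComplexity_perPoly`, discharged over `ℂ`) and Grenet's
`dc(per_n) ≤ 2ⁿ − 1` (`determinantalComplexity_perPoly_le`, discharged) — so the new content is the
lower bounds `7 ≤ dc(per_3)` and `9 ≤ dc(per_4)`.

Grounds route `ValiantsHypothesis/GrenetRigidity`: the "known value dc(per_3) = 7" used by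
`OptimalUnique`/`OptimalUniqueThree`/`WindowStability` at `n = 3`, and the printed state of
knowledge `9 ≤ dc(per_4) ≤ 15` behind crux `DcPerFour` (`dc(per_4) = 15`, STRONGER than print).

## References

* [AlperBogartVelasco2017] J. Alper, T. Bogart, M. Velasco, Found. Comput. Math. 17 (2017)
  829–836, doi:10.1007/s10208-015-9300-x, arXiv:1505.02205 — Corollary 1.4 (with Theorem 1.2,
  Corollary 1.3).
-/

namespace Literature.Computability.AlgebraicComplexity

/-- **Alper–Bogart–Velasco 2017, Corollary 1.4** (verbatim: "Let `k` be a field with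
`char(k) ≠ 2`. Then `dc(perm_3) = 7` and `dc(perm_4) ≥ 9`."), for the tree's affine determinantal
complexity `determinantalComplexity` of `perPoly (Fin 3) k` and `perPoly (Fin 4) k`; `char(k) ≠ 2`
is `ringChar k ≠ 2`. The upper bound `dc(perm_3) ≤ 7` inside the equality is Grenet's (proved in the
tree for every field: `determinantalComplexity_perPoly_le_holds`); the lower bounds come from
Theorem 1.2 (`dc(f) ≥ codim Sing(f) + 1`) with `codim Sing(perm_3) = 6`, `codim Sing(perm_4) = 8`.
[cite: AlperBogartVelasco2017, Corollary 1.4] -/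
def alperBogartVelasco2017_cor_1_4 : Prop :=
  ∀ (k : Type*) [Field k], ringChar k ≠ 2 →
    determinantalComplexity (perPoly (Fin 3) k) = 7 ∧ 9 ≤ determinantalComplexity (perPoly (Fin 4) k)

/-- The `ℂ` instance of Alper–Bogart–Velasco, Cor. 1.4: `dc(per_3) = 7` and `9 ≤ dc(per_4)` over `ℂ`
(`ringChar ℂ = 0 ≠ 2`). A one-line consequence of the named fact, recorded for the routes over `ℂ`.
[cite: AlperBogartVelasco2017, Corollary 1.4] -/
theorem alperBogartVelasco2017_cor_1_4_complex (h : alperBogartVelasco2017_cor_1_4.{0}) :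
    determinantalComplexity (perPoly (Fin 3) ℂ) = 7 ∧ 9 ≤ determinantalComplexity (perPoly (Fin 4) ℂ) :=
  h ℂ (by rw [ringChar.eq_zero]; decide)

end Literature.Computability.AlgebraicComplexity
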